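import Literature.MathematicalPhysics.QuantumLattice.TwistedSpaceGroupUnitary
import Literature.MathematicalPhysics.QuantumLattice.HubbardSpinFlipSymmetry
import HarnessLib

/-!
# The gauge-twisted space group WITH SPIN EXCHANGE (`B₁g` singlet pair field)

`TwistedSpaceGroupUnitary` twists the `b₁g`-odd lattice elements by the gauge quarter turn `𝒢` so that the
`d`-wave pair field is fixed. The SPIN EXCHANGE `F : c_{x↑} ↔ c_{x↓}` also reverses a singlet pair
(`Δ_{xy} = (c_{x↑}c_{y↓} − c_{x↓}c_{y↑})/√2 ↦ −Δ_{xy}`), so in eng-2's «D₄ × flip» one-point builds it is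
twisted the same way (`F ↦ F ∘ 𝒢`). This file adds the flip: the family
`T((v, γ), f, m) = U_v D_γ F^f 𝒢_{j(γ) + f + 2m}` on `(((ℤ/L)² × S) × Fin 2) × Fin 2`, with the facts the
orbit-state certificate reader asks for (unitary; commutes with `H^{tt'}_L` and with the TOTAL particle number
`N̂` — not with `N_σ`, which the flip exchanges; closed under right multiplication by members and by
translations), plus `relabel_spinSwap_localPair` (`F Φ_x F⁻¹ = −Φ_x`) and the commutation of the spin exchange
with the space group and with `𝒢`.

Everything is PROVED; no named fact. Benfatto–Giuliani–Mastropietro 2006 §2.1 (spin exchange symmetry of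
the Hubbard Hamiltonian), Bratteli–Robinson II §5.2.2/§6.2.4, Han 2020 §3, Scalapino 1995 §2.

References: G. Benfatto, A. Giuliani, V. Mastropietro, Ann. Henri Poincaré 7 (2006) 809, §2.1
[BenfattoGiulianiMastropietro2006]; O. Bratteli, D. W. Robinson, *Operator Algebras and Quantum Statistical
Mechanics 2*, §6.2.4 [BratteliRobinsonII1997]; X. Han, arXiv:2006.06002 §3 [Han2020Bootstrap]; D. J. Scalapino,
Phys. Rep. 250 (1995) 329, §2 eq. (2.2) [Scalapino1995].
-/

noncomputable section

namespace Literature.MathematicalPhysics.QuantumLattice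

open Matrix Finset Complex HubbardWave0 Literature.Probability.LatticeModels
open Literature.MathematicalPhysics.QuantumManyBody.StateRelaxation
open scoped ComplexOrder BigOperators

section Torus

variable {L : ℕ} [NeZero L]

/-- (Local to this section.) [folklore] -/
local instance (priority := high) instDecidableEqFermionTorusTwFlip : DecidableEq (FermionTorus 2 L) :=
  LinearOrder.toDecidableEq

/-- The spin-exchange unitary `F` (`c_{xσ} ↦ c_{x,1−σ}`) on the torus Fock space.
[cite: BenfattoGiulianiMastropietro2006, §2.1] -/
def fockSpinFlip : Matrix (Finset (Orb (FermionTorus 2 L))) (Finset (Orb (FermionTorus 2 L))) ℂ :=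
  (fockRelabel (Orb.spinSwap : Orb (FermionTorus 2 L) ≃ Orb (FermionTorus 2 L))).val

omit [NeZero L] in
/-- Unfolding. [cite: BenfattoGiulianiMastropietro2006, §2.1] -/
theorem fockSpinFlip_def :
    (fockSpinFlip : Matrix (Finset (Orb (FermionTorus 2 L))) _ ℂ) =
      (fockRelabel (Orb.spinSwap : Orb (FermionTorus 2 L) ≃ Orb (FermionTorus 2 L))).val := rfl

omit [NeZero L] in
/-- `F` is unitary: `Fᴴ F = 1`. [cite: BratteliRobinsonII1997, §5.2.2] -/
theorem fockSpinFlip_conjTranspose_mul_self :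
    (fockSpinFlip : Matrix (Finset (Orb (FermionTorus 2 L))) _ ℂ)ᴴ * fockSpinFlip = 1 := by
  rw [fockSpinFlip_def, fockRelabel_val]
  exact fockRelabel_conjTranspose_mul_self _

/-- `F F = 1` (the spin exchange is an involution). [cite: BenfattoGiulianiMastropietro2006, §2.1] -/
theorem fockSpinFlip_mul_self :
    (fockSpinFlip : Matrix (Finset (Orb (FermionTorus 2 L))) _ ℂ) * fockSpinFlip = 1 := by
  have h : (Orb.spinSwap : Orb (FermionTorus 2 L) ≃ Orb (FermionTorus 2 L)) * Orb.spinSwap = 1 := by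
    ext o : 1
    obtain ⟨x, σ, rfl⟩ : ∃ x : TorusSite 2 L, ∃ σ : Fin 2, o = orb (FermionTorus.ofTorusSite x) σ :=
      ⟨FermionTorus.toTorusSite (ofLex o).1, (ofLex o).2, by rw [FermionTorus.ofTorusSite_toTorusSite]; rfl⟩
    rw [Equiv.Perm.mul_apply, Orb.spinSwap_orb, Orb.spinSwap_orb, Equiv.swap_apply_self, Equiv.Perm.one_apply]
  have h2 : fockRelabel (Orb.spinSwap : Orb (FermionTorus 2 L) ≃ Orb (FermionTorus 2 L)) * fockRelabel Orb.spinSwap = 1 := by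
    rw [← map_mul, h, map_one]
  exact congrArg Subtype.val h2

/-- `F^a = F^(a mod 2)`. [cite: BenfattoGiulianiMastropietro2006, §2.1] -/
theorem fockSpinFlip_pow_eq_pow_mod_two (a : ℕ) :
    (fockSpinFlip : Matrix (Finset (Orb (FermionTorus 2 L))) _ ℂ) ^ a = fockSpinFlip ^ (a % 2) := by
  conv_lhs => rw [← Nat.div_add_mod a 2, pow_add, pow_mul, sq, fockSpinFlip_mul_self, one_pow, one_mul]

/-- `Fᴴ = F`. [cite: BenfattoGiulianiMastropietro2006, §2.1] -/
theorem conjTranspose_fockSpinFlip :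
    (fockSpinFlip : Matrix (Finset (Orb (FermionTorus 2 L))) _ ℂ)ᴴ = fockSpinFlip := by
  have h := fockSpinFlip_conjTranspose_mul_self (L := L)
  calc (fockSpinFlip : Matrix (Finset (Orb (FermionTorus 2 L))) _ ℂ)ᴴ
      = fockSpinFlipᴴ * (fockSpinFlip * fockSpinFlip) := by rw [fockSpinFlip_mul_self, Matrix.mul_one]
    _ = fockSpinFlip := by rw [← Matrix.mul_assoc, h, Matrix.one_mul]

/-- `(F^a)ᴴ F^a = 1`. [cite: BratteliRobinsonII1997, §5.2.2] -/
theorem fockSpinFlip_pow_conjTranspose_mul_self (a : ℕ) :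
    ((fockSpinFlip : Matrix (Finset (Orb (FermionTorus 2 L))) _ ℂ) ^ a)ᴴ * fockSpinFlip ^ a = 1 := by
  rw [conjTranspose_pow, conjTranspose_fockSpinFlip, ← pow_add, ← two_mul, pow_mul, sq, fockSpinFlip_mul_self,
    one_pow]

/-- The spin exchange commutes with the translations (as orbital permutations). [cite: Han2020Bootstrap, §3] -/
theorem Orb.spinSwap_mul_translate (v : TorusSite 2 L) :
    (Orb.spinSwap : Equiv.Perm (Orb (FermionTorus 2 L))) * Orb.translate v = Orb.translate v * Orb.spinSwap := by
  ext o : 1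
  obtain ⟨x, σ, rfl⟩ : ∃ x : TorusSite 2 L, ∃ σ : Fin 2, o = orb (FermionTorus.ofTorusSite x) σ :=
    ⟨FermionTorus.toTorusSite (ofLex o).1, (ofLex o).2, by rw [FermionTorus.ofTorusSite_toTorusSite]; rfl⟩
  rw [Equiv.Perm.mul_apply, Equiv.Perm.mul_apply, Orb.translate_orb, Orb.spinSwap_orb, Orb.spinSwap_orb,
    Orb.translate_orb]

/-- The spin exchange commutes with the point group (as orbital permutations). [cite: Han2020Bootstrap, §3] -/
theorem Orb.spinSwap_mul_d4Perm (γ : DihedralGroup 4) :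
    (Orb.spinSwap : Equiv.Perm (Orb (FermionTorus 2 L))) * Orb.d4Perm γ = Orb.d4Perm γ * Orb.spinSwap := by
  ext o : 1
  obtain ⟨x, σ, rfl⟩ : ∃ x : TorusSite 2 L, ∃ σ : Fin 2, o = orb (FermionTorus.ofTorusSite x) σ :=
    ⟨FermionTorus.toTorusSite (ofLex o).1, (ofLex o).2, by rw [FermionTorus.ofTorusSite_toTorusSite]; rfl⟩
  rw [Equiv.Perm.mul_apply, Equiv.Perm.mul_apply, Orb.d4Perm_orb, Orb.spinSwap_orb, Orb.spinSwap_orb, Orb.d4Perm_orb]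

/-- `F` commutes with the space-group unitaries `U_v D_γ`. [cite: Han2020Bootstrap, §3] -/
theorem fockSpinFlip_commute_spaceGroupUnitary (S : Finset (DihedralGroup 4)) (g : TorusSite 2 L × ↥S) :
    Commute (fockSpinFlip : Matrix (Finset (Orb (FermionTorus 2 L))) _ ℂ) (spaceGroupUnitary S g) := by
  have hT' : fockRelabel (Orb.spinSwap : Orb (FermionTorus 2 L) ≃ Orb (FermionTorus 2 L)) * fockTranslate (L := L) g.1 =
      fockTranslate g.1 * fockRelabel Orb.spinSwap := by
    rw [fockTranslate, ← map_mul, Orb.spinSwap_mul_translate, map_mul]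
  have hT : fockSpinFlip * (fockTranslate (L := L) g.1).val = (fockTranslate g.1).val * fockSpinFlip :=
    congrArg Subtype.val hT'
  have hD' : fockRelabel (Orb.spinSwap : Orb (FermionTorus 2 L) ≃ Orb (FermionTorus 2 L)) * fockD4 (L := L) (g.2 : DihedralGroup 4) =
      fockD4 (L := L) (g.2 : DihedralGroup 4) * fockRelabel Orb.spinSwap := by
    rw [fockD4_apply, ← map_mul, Orb.spinSwap_mul_d4Perm, map_mul]
  have hD : fockSpinFlip * (fockD4 (L := L) (g.2 : DihedralGroup 4)).val =
      (fockD4 (L := L) (g.2 : DihedralGroup 4)).val * fockSpinFlip :=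
    congrArg Subtype.val hD'
  show fockSpinFlip * ((fockTranslate g.1).val * (fockD4 (L := L) (g.2 : DihedralGroup 4)).val) =
    (fockTranslate g.1).val * (fockD4 (L := L) (g.2 : DihedralGroup 4)).val * fockSpinFlip
  rw [← Matrix.mul_assoc, hT, Matrix.mul_assoc, hD, Matrix.mul_assoc]

/-- The spin exchange fixes the total particle number. [cite: BenfattoGiulianiMastropietro2006, §2.1] -/
theorem relabel_spinSwap_totalNumber {Λ : Type*} [LinearOrder Λ] [Fintype Λ] :
    relabel (Orb.spinSwap : Orb Λ ≃ Orb Λ) (totalNumber : Matrix (Finset (Orb Λ)) (Finset (Orb Λ)) ℂ) = totalNumber := by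
  rw [totalNumber, map_sum]
  refine Finset.sum_congr rfl fun x _ => ?_
  rw [map_sum]
  refine Fintype.sum_equiv (Equiv.swap (0 : Fin 2) 1) _ _ fun σ => ?_
  rw [numberOp, map_mul, relabel_creation, relabel_annihilation, Orb.spinSwap_orb, numberOp]

omit [NeZero L] in
/-- `F` commutes with `N̂`. [cite: BenfattoGiulianiMastropietro2006, §2.1] -/
theorem fockSpinFlip_commute_totalNumber :
    Commute (fockSpinFlip : Matrix (Finset (Orb (FermionTorus 2 L))) _ ℂ) totalNumber := by
  rw [fockSpinFlip_def]
  exact fockRelabel_commute_of_relabel_eq _ relabel_spinSwap_totalNumber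

omit [NeZero L] in
/-- `F` commutes with the `t–t'` Hubbard Hamiltonian (spin-exchange symmetry). [cite: BenfattoGiulianiMastropietro2006, §2.1] -/
theorem fockSpinFlip_commute_hubbardTorusTT' (t t' U : ℝ) :
    Commute (fockSpinFlip : Matrix (Finset (Orb (FermionTorus 2 L))) _ ℂ) (hubbardTorusTT' L t t' U) := by
  rw [fockSpinFlip_def]
  refine fockRelabel_commute_of_relabel_eq _ ?_
  rw [hubbardTorusTT', map_add, relabel_spinSwap_hamiltonian, relabel_spinSwap_hamiltonian]

omit [NeZero L] in
/-- `F` commutes with the gauge unitaries. [cite: BratteliRobinsonII1997, §5.2.2] -/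
theorem fockGauge_commute_fockSpinFlip (k : ℕ) :
    Commute (fockGauge k) (fockSpinFlip : Matrix (Finset (Orb (FermionTorus 2 L))) _ ℂ) := by
  refine Commute.fockGauge_of_totalNumberOp ?_ k
  rw [totalNumberOp_eq_totalNumber]
  exact fockSpinFlip_commute_totalNumber.symm

/-- **The singlet pair is odd under spin exchange**: `F Φ^g_x F⁻¹ = −Φ^g_x` (the same statement exists Summits-side as the
route-local `Summit.HubbardSuperconductivity.HubbardSuperconductivity.Theorems.LiebTwinFlip.relabel_spinSwap_localPair`, which
Literature cannot import; re-homed here as `relabel_spinSwap_numberOp` was in `HubbardSpinFlipSymmetry`). [cite: Scalapino1995, §2 eq. (2.2)] -/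
theorem relabel_spinSwap_localPair (g : Site 2 → ℝ) (x : TorusSite 2 L) :
    relabel (Orb.spinSwap : Orb (FermionTorus 2 L) ≃ Orb (FermionTorus 2 L)) (localPair g L x) = -localPair g L x := by
  rw [localPair, map_sum, ← Finset.sum_neg_distrib]
  refine Finset.sum_congr rfl fun e _ => ?_
  rw [map_smul, ← smul_neg, map_sub, map_mul, map_mul, relabel_annihilation, relabel_annihilation,
    relabel_annihilation, relabel_annihilation, Orb.spinSwap_orb, Orb.spinSwap_orb, Orb.spinSwap_orb,
    Orb.spinSwap_orb, Equiv.swap_apply_left, Equiv.swap_apply_right, neg_sub]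

/-- `F^a Φ_x (F^a)ᴴ = (−1)^a Φ_x`. [cite: Scalapino1995, §2 eq. (2.2)] -/
theorem fockSpinFlip_pow_conj_localPair (g : Site 2 → ℝ) (x : TorusSite 2 L) (a : ℕ) :
    fockSpinFlip ^ a * localPair g L x * (fockSpinFlip ^ a)ᴴ = ((-1 : ℂ) ^ a) • localPair g L x := by
  induction a with
  | zero => simp
  | succ a ih =>
    rw [pow_succ, conjTranspose_mul,
      show fockSpinFlip ^ a * fockSpinFlip * localPair g L x * (fockSpinFlipᴴ * (fockSpinFlip ^ a)ᴴ) =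
        fockSpinFlip ^ a * (fockSpinFlip * localPair g L x * fockSpinFlipᴴ) * (fockSpinFlip ^ a)ᴴ by
          simp only [Matrix.mul_assoc],
      fockSpinFlip_def, ← relabel_eq_fockRelabel_conj, relabel_spinSwap_localPair, ← fockSpinFlip_def,
      Matrix.mul_neg, Matrix.neg_mul, ih, pow_succ, mul_neg_one, neg_smul]

/-! ### The flip-twisted family -/

/-- The twist exponent with flip: `e(γ, f, m) = j(γ) + f + 2m`. [cite: BratteliRobinsonII1997, §5.2.2] -/
def twistFlipExp (γ : DihedralGroup 4) (f m : Fin 2) : ℕ := b1gTwist γ + f.val + 2 * m.val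

/-- **The flip-twisted space-group unitaries** `T((v, γ), f, m) = U_v D_γ F^f 𝒢_{j(γ)+f+2m}`.
[cite: BratteliRobinsonII1997, §6.2.4] -/
def twistedFlipSpaceGroupUnitary (S : Finset (DihedralGroup 4)) :
    ((TorusSite 2 L × ↥S) × Fin 2) × Fin 2 →
      Matrix (Finset (Orb (FermionTorus 2 L))) (Finset (Orb (FermionTorus 2 L))) ℂ :=
  fun g => spaceGroupUnitary S g.1.1 * fockSpinFlip ^ g.1.2.val *
    fockGauge (twistFlipExp (g.1.1.2 : DihedralGroup 4) g.1.2 g.2)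

/-- Unfolding. [cite: BratteliRobinsonII1997, §6.2.4] -/
theorem twistedFlipSpaceGroupUnitary_apply (S : Finset (DihedralGroup 4)) (g : ((TorusSite 2 L × ↥S) × Fin 2) × Fin 2) :
    twistedFlipSpaceGroupUnitary S g = spaceGroupUnitary S g.1.1 * fockSpinFlip ^ g.1.2.val *
      fockGauge (twistFlipExp (g.1.1.2 : DihedralGroup 4) g.1.2 g.2) := rfl

/-- Unitarity. [cite: BratteliRobinsonII1997, §6.2.4] -/
theorem twistedFlipSpaceGroupUnitary_conjTranspose_mul_self (S : Finset (DihedralGroup 4))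
    (g : ((TorusSite 2 L × ↥S) × Fin 2) × Fin 2) :
    (twistedFlipSpaceGroupUnitary S g)ᴴ * twistedFlipSpaceGroupUnitary S g = 1 := by
  have hU : (spaceGroupUnitary S g.1.1)ᴴ * spaceGroupUnitary S g.1.1 = 1 := d4Affine_conjTranspose_mul_self _ _
  rw [twistedFlipSpaceGroupUnitary_apply, conjTranspose_mul, conjTranspose_mul, Matrix.mul_assoc, Matrix.mul_assoc,
    ← Matrix.mul_assoc (spaceGroupUnitary S g.1.1)ᴴ, ← Matrix.mul_assoc (spaceGroupUnitary S g.1.1)ᴴ, hU,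
    Matrix.one_mul, ← Matrix.mul_assoc ((fockSpinFlip ^ g.1.2.val)ᴴ), fockSpinFlip_pow_conjTranspose_mul_self,
    Matrix.one_mul, fockGauge_conjTranspose_mul_self]

/-- `T(g)` commutes with the `t–t'` Hubbard Hamiltonian. [cite: BenfattoGiulianiMastropietro2006, §2.1] -/
theorem twistedFlipSpaceGroupUnitary_mul_hubbardTorusTT' (S : Finset (DihedralGroup 4)) (t t' U : ℝ)
    (g : ((TorusSite 2 L × ↥S) × Fin 2) × Fin 2) :
    twistedFlipSpaceGroupUnitary S g * hubbardTorusTT' L t t' U =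
      hubbardTorusTT' L t t' U * twistedFlipSpaceGroupUnitary S g := by
  have hG : Commute (fockGauge (twistFlipExp (g.1.1.2 : DihedralGroup 4) g.1.2 g.2)) (hubbardTorusTT' L t t' U) := by
    refine Commute.fockGauge_of_totalNumberOp ?_ _
    rw [totalNumberOp_eq_totalNumber]
    exact (hubbardTorusTT'_commute_totalNumber L t t' U).symm
  have hF : Commute (fockSpinFlip ^ g.1.2.val : Matrix (Finset (Orb (FermionTorus 2 L))) _ ℂ) (hubbardTorusTT' L t t' U) :=
    (fockSpinFlip_commute_hubbardTorusTT' t t' U).pow_left _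
  rw [twistedFlipSpaceGroupUnitary_apply, Matrix.mul_assoc, Matrix.mul_assoc, hG.eq, ← Matrix.mul_assoc (fockSpinFlip ^ _),
    hF.eq, ← Matrix.mul_assoc, ← Matrix.mul_assoc, spaceGroupUnitary_mul_hubbardTorusTT', Matrix.mul_assoc,
    Matrix.mul_assoc, Matrix.mul_assoc]

/-- `T(g)` commutes with the TOTAL particle number `N̂` (not with `N_σ`: the flip exchanges them).
[cite: BenfattoGiulianiMastropietro2006, §2.1] -/
theorem twistedFlipSpaceGroupUnitary_commute_totalNumber (S : Finset (DihedralGroup 4))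
    (g : ((TorusSite 2 L × ↥S) × Fin 2) × Fin 2) :
    twistedFlipSpaceGroupUnitary S g * totalNumber = totalNumber * twistedFlipSpaceGroupUnitary S g := by
  have hS : Commute (spaceGroupUnitary S g.1.1) (totalNumber : Matrix (Finset (Orb (FermionTorus 2 L))) _ ℂ) := by
    have h := (commute_totalNumberOp_spaceGroupUnitary S g.1.1).symm
    rwa [totalNumberOp_eq_totalNumber] at h
  have hF : Commute (fockSpinFlip ^ g.1.2.val : Matrix (Finset (Orb (FermionTorus 2 L))) _ ℂ) totalNumber :=
    fockSpinFlip_commute_totalNumber.pow_left _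
  have hG : Commute (fockGauge (twistFlipExp (g.1.1.2 : DihedralGroup 4) g.1.2 g.2))
      (totalNumber : Matrix (Finset (Orb (FermionTorus 2 L))) _ ℂ) := by
    refine Commute.fockGauge_of_totalNumberOp ?_ _
    rw [totalNumberOp_eq_totalNumber]
  rw [twistedFlipSpaceGroupUnitary_apply]
  exact ((hS.mul_left hF).mul_left hG).eq

/-- The index map of right multiplication by the member `(((w₀, γ₀), f₀), m₀)`. [cite: Han2020Bootstrap, §3] -/
def twistFlipMulIndex {S : Finset (DihedralGroup 4)} (hmul : ∀ a ∈ S, ∀ b ∈ S, a * b ∈ S)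
    (w₀ : TorusSite 2 L) {γ₀ : DihedralGroup 4} (hγ₀ : γ₀ ∈ S) (f₀ m₀ : Fin 2)
    (g : ((TorusSite 2 L × ↥S) × Fin 2) × Fin 2) : ((TorusSite 2 L × ↥S) × Fin 2) × Fin 2 :=
  (((g.1.1.1 + d4Site (g.1.1.2 : DihedralGroup 4) w₀, ⟨(g.1.1.2 : DihedralGroup 4) * γ₀, hmul _ g.1.1.2.2 _ hγ₀⟩),
      ⟨(g.1.2.val + f₀.val) % 2, Nat.mod_lt _ (by norm_num)⟩),
    ⟨(g.2.val + m₀.val + twistCarry (g.1.1.2 : DihedralGroup 4) γ₀ + (g.1.2.val + f₀.val) / 2) % 2,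
      Nat.mod_lt _ (by norm_num)⟩)

omit [NeZero L] in
/-- The index map is injective. [cite: Han2020Bootstrap, §3] -/
theorem twistFlipMulIndex_injective {S : Finset (DihedralGroup 4)} (hmul : ∀ a ∈ S, ∀ b ∈ S, a * b ∈ S)
    (w₀ : TorusSite 2 L) {γ₀ : DihedralGroup 4} (hγ₀ : γ₀ ∈ S) (f₀ m₀ : Fin 2) :
    Function.Injective (twistFlipMulIndex (L := L) hmul w₀ hγ₀ f₀ m₀) := by
  rintro ⟨⟨⟨w, γ, hγ⟩, f⟩, m⟩ ⟨⟨⟨w', γ', hγ'⟩, f'⟩, m'⟩ h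
  simp only [twistFlipMulIndex, Prod.mk.injEq, Subtype.mk.injEq, Fin.mk.injEq] at h
  obtain ⟨⟨⟨h1, h2⟩, h3⟩, h4⟩ := h
  have hγγ : γ = γ' := mul_right_cancel h2
  subst hγγ
  have hw : w = w' := add_right_cancel h1
  subst hw
  have hf : f = f' := by
    have hf2 : f.val % 2 = f'.val % 2 := by omega
    exact Fin.ext (by rw [Nat.mod_eq_of_lt f.isLt, Nat.mod_eq_of_lt f'.isLt] at hf2; exact hf2)
  subst hf
  have hm : m = m' := by
    have hm2 : m.val % 2 = m'.val % 2 := by omega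
    exact Fin.ext (by rw [Nat.mod_eq_of_lt m.isLt, Nat.mod_eq_of_lt m'.isLt] at hm2; exact hm2)
  subst hm
  rfl

omit [NeZero L] in
/-- The twist exponents add up modulo four under the index map. [cite: Han2020Bootstrap, §3] -/
theorem twistFlipExp_add_mod_four {S : Finset (DihedralGroup 4)} (hmul : ∀ a ∈ S, ∀ b ∈ S, a * b ∈ S)
    (w₀ : TorusSite 2 L) {γ₀ : DihedralGroup 4} (hγ₀ : γ₀ ∈ S) (f₀ m₀ : Fin 2)
    (g : ((TorusSite 2 L × ↥S) × Fin 2) × Fin 2) :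
    (twistFlipExp (g.1.1.2 : DihedralGroup 4) g.1.2 g.2 + twistFlipExp γ₀ f₀ m₀) % 4 =
      twistFlipExp ((twistFlipMulIndex (L := L) hmul w₀ hγ₀ f₀ m₀ g).1.1.2 : DihedralGroup 4)
        (twistFlipMulIndex (L := L) hmul w₀ hγ₀ f₀ m₀ g).1.2 (twistFlipMulIndex (L := L) hmul w₀ hγ₀ f₀ m₀ g).2 % 4 := by
  have hadd := b1gTwist_add (g.1.1.2 : DihedralGroup 4) γ₀
  simp only [twistFlipExp, twistFlipMulIndex]
  omega

omit [NeZero L] in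
/-- The flip exponents add up modulo two under the index map. [cite: Han2020Bootstrap, §3] -/
theorem flipExp_add_mod_two {S : Finset (DihedralGroup 4)} (hmul : ∀ a ∈ S, ∀ b ∈ S, a * b ∈ S)
    (w₀ : TorusSite 2 L) {γ₀ : DihedralGroup 4} (hγ₀ : γ₀ ∈ S) (f₀ m₀ : Fin 2)
    (g : ((TorusSite 2 L × ↥S) × Fin 2) × Fin 2) :
    (g.1.2.val + f₀.val) % 2 = (twistFlipMulIndex (L := L) hmul w₀ hγ₀ f₀ m₀ g).1.2.val := by
  simp only [twistFlipMulIndex]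

/-- **Closure of the flip-twisted family under right multiplication by a member.** [cite: Han2020Bootstrap, §3] -/
theorem twistedFlipSpaceGroupUnitary_closed {S : Finset (DihedralGroup 4)} (hmul : ∀ a ∈ S, ∀ b ∈ S, a * b ∈ S)
    (w₀ : TorusSite 2 L) {γ₀ : DihedralGroup 4} (hγ₀ : γ₀ ∈ S) (f₀ m₀ : Fin 2) :
    ∃ σ : (((TorusSite 2 L × ↥S) × Fin 2) × Fin 2) ≃ (((TorusSite 2 L × ↥S) × Fin 2) × Fin 2), ∀ g,
      twistedFlipSpaceGroupUnitary S g * twistedFlipSpaceGroupUnitary S (((w₀, ⟨γ₀, hγ₀⟩), f₀), m₀) =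
        twistedFlipSpaceGroupUnitary S (σ g) := by
  refine ⟨Equiv.ofBijective _ (Finite.injective_iff_bijective.mp
    (twistFlipMulIndex_injective (L := L) hmul w₀ hγ₀ f₀ m₀)), fun g => ?_⟩
  rw [Equiv.ofBijective_apply, twistedFlipSpaceGroupUnitary_apply, twistedFlipSpaceGroupUnitary_apply,
    twistedFlipSpaceGroupUnitary_apply]
  set e₁ := twistFlipExp (g.1.1.2 : DihedralGroup 4) g.1.2 g.2 with he₁
  set e₂ := twistFlipExp γ₀ f₀ m₀ with he₂
  set A := spaceGroupUnitary S g.1.1 with hA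
  set B := spaceGroupUnitary S (w₀, ⟨γ₀, hγ₀⟩) with hB
  set F : Matrix (Finset (Orb (FermionTorus 2 L))) _ ℂ := fockSpinFlip with hF
  -- `A F^a 𝒢₁ · B F^b 𝒢₂ = (A B) F^{a+b} 𝒢_{e₁+e₂}`
  have hGB : fockGauge e₁ * B = B * fockGauge e₁ := (fockGauge_commute_spaceGroupUnitary S _ _).eq
  have hGF : ∀ b : ℕ, fockGauge e₁ * F ^ b = F ^ b * fockGauge e₁ := fun b =>
    ((fockGauge_commute_fockSpinFlip e₁).pow_right b).eq
  have hFB : ∀ a : ℕ, F ^ a * B = B * F ^ a := fun a => ((fockSpinFlip_commute_spaceGroupUnitary S _).pow_left a).eq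
  have step : A * F ^ g.1.2.val * fockGauge e₁ * (B * F ^ f₀.val * fockGauge e₂) =
      A * B * F ^ (g.1.2.val + f₀.val) * fockGauge (e₁ + e₂) := by
    rw [pow_add, ← fockGauge_mul]
    simp only [Matrix.mul_assoc]
    rw [← Matrix.mul_assoc (fockGauge e₁) B, hGB, Matrix.mul_assoc B, ← Matrix.mul_assoc (fockGauge e₁) (F ^ f₀.val),
      hGF, Matrix.mul_assoc (F ^ f₀.val), ← Matrix.mul_assoc (F ^ g.1.2.val) B, hFB, Matrix.mul_assoc B]
  rw [step, fockSpinFlip_pow_eq_pow_mod_two (g.1.2.val + f₀.val),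
    fockGauge_eq_of_mod_four_eq (twistFlipExp_add_mod_four (L := L) hmul w₀ hγ₀ f₀ m₀ g),
    flipExp_add_mod_two (L := L) hmul w₀ hγ₀ f₀ m₀ g, hA, hB,
    show spaceGroupUnitary S (w₀, ⟨γ₀, hγ₀⟩) = (fockTranslate w₀).val * (fockD4 (L := L) γ₀).val from rfl,
    spaceGroupUnitary_mul_affine hmul g.1.1 w₀ hγ₀]
  rfl

/-- **Closure under translations** (`1 ∈ S`). [cite: Han2020Bootstrap, §3] -/
theorem twistedFlipSpaceGroupUnitary_closed_translate {S : Finset (DihedralGroup 4)} (h1 : (1 : DihedralGroup 4) ∈ S)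
    (hmul : ∀ a ∈ S, ∀ b ∈ S, a * b ∈ S) (v : TorusSite 2 L) :
    ∃ σ : (((TorusSite 2 L × ↥S) × Fin 2) × Fin 2) ≃ (((TorusSite 2 L × ↥S) × Fin 2) × Fin 2), ∀ g,
      twistedFlipSpaceGroupUnitary S g * (fockTranslate v).val = twistedFlipSpaceGroupUnitary S (σ g) := by
  obtain ⟨σ, hσ⟩ := twistedFlipSpaceGroupUnitary_closed (L := L) hmul v h1 0 0
  refine ⟨σ, fun g => ?_⟩
  have h := hσ g
  have he : twistFlipExp (1 : DihedralGroup 4) (0 : Fin 2) (0 : Fin 2) = 0 := by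
    simp only [twistFlipExp, b1gTwist_one, Fin.val_zero, mul_zero, add_zero]
  have hsg : spaceGroupUnitary S (v, ⟨1, h1⟩) = (fockTranslate v).val := by
    show (fockTranslate v).val * (fockD4 (L := L) (1 : DihedralGroup 4)).val = _
    rw [map_one, show ((1 : Matrix.unitaryGroup (Finset (Orb (FermionTorus 2 L))) ℂ).val :
      Matrix (Finset (Orb (FermionTorus 2 L))) (Finset (Orb (FermionTorus 2 L))) ℂ) = 1 from rfl, Matrix.mul_one]
  have h0 : twistedFlipSpaceGroupUnitary S (((v, ⟨1, h1⟩), (0 : Fin 2)), (0 : Fin 2)) = (fockTranslate v).val := by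
    rw [twistedFlipSpaceGroupUnitary_apply]
    show spaceGroupUnitary S (v, ⟨1, h1⟩) * fockSpinFlip ^ (0 : Fin 2).val *
      fockGauge (twistFlipExp (1 : DihedralGroup 4) (0 : Fin 2) (0 : Fin 2)) = _
    rw [he, fockGauge_zero, Matrix.mul_one, Fin.val_zero, pow_zero, Matrix.mul_one, hsg]
  calc twistedFlipSpaceGroupUnitary S g * (fockTranslate v).val
      = twistedFlipSpaceGroupUnitary S g * twistedFlipSpaceGroupUnitary S (((v, ⟨1, h1⟩), (0 : Fin 2)), (0 : Fin 2)) := by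
        rw [h0]
    _ = twistedFlipSpaceGroupUnitary S (σ g) := h

end Torus

end Literature.MathematicalPhysics.QuantumLattice

end
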